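import Summits.NavierStokesRegularity.NavierStokesRegularity.Theorems.LerayQuarterDissipationFiniteDissipationLiouvilleCalmVorticity
import Literature.Analysis.FluidPDE.VorticityEquation
import Literature.Analysis.FluidPDE.AncientSimilarityVorticity
import HarnessLib

/-!
# Crux `FiniteDissipationLiouville` (stmt-NavierStokesRegularity-22144): the vorticity
# unsteadiness IS the similarity-time derivative of the vorticity — the vorticity-calm criterion and
# the vorticity-flicker floor in the language of `ω = curl w`

Theorems file of route `LerayQuarterDissipation` (lead prover g14; `--supports` the crux; sequel of
`…CalmVorticity`). Navier–Stokes regularity is NOT proved by anything here; no summit is.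

`…CalmVorticity` states its criterion through `curl Φₜ`, `Φₜ(x) = (−t)∂ₜw − ½w − ½(x·∇)w` being the
(unscaled) unsteadiness field. Here the identity `curl((x·∇)w) = ω + (x·∇)ω`
(`curl_fderiv_apply_self`) and `curl ∂ₜ = ∂ₜ curl` for the jointly smooth class
(`IsSmoothSpaceTimeOn.curl_timeDerivWithin`) give

* `curl_unsteadiness_eq` — `curl Φₜ = (−t)∂ₜω − ω − ½(x·∇)ω`, `ω(t) = curl (w t)`: the vorticity
  unsteadiness `(−t) • curl Φₜ` is `∂ₛΩ` for the similarity vorticity `Ω(y,s) = (−t)ω(√(−t)y, t)`;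
* `eq_zero_of_vorticity_steady_on` — **ONE INSTANT AT WHICH THE SIMILARITY VORTICITY IS STEADY ON
  ONE OPEN SET KILLS A MEMBER OF THE STRATUM**: `(−t₀)∂ₜω − ω − ½(x·∇)ω = 0` on a non-empty open set at
  one `t₀ < 0` ⇒ `w ≡ 0` on the past;
* `vorticityCalm_leaf'`, `vorticityFlicker_floor_of_singular'` — the leaf and the PORTRAIT of
  `…CalmVorticity` restated literally for `∂ₛΩ`: **at every instant and in every parabolic sub-ball
  `B(x₀, r√(−t))`, `‖x₀‖ ≤ ρ√(−t)`, of a finite-dissipation Type-I singularity,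
  `(−t)‖(−t)∂ₜω − ω − ½(x·∇)ω‖ > δ(C,K,ρ,r)` somewhere** — the vorticity never settles into a
  self-similar (steady-in-similarity-variables) configuration on any parabolic pocket.

HONEST FRAMING: restatements (portrait); `δ` ineffective; nothing removed for the DSS wall.

References: Majda–Bertozzi (2002) §1.1; Pineau–Vicol, arXiv:2607.09619 (2026) §1.3;
Koch–Nadirashvili–Seregin–Šverák, arXiv:0709.3599 Prop. 4.1 (joint smoothness).
-/

noncomputable section

-- the summit and its single sub-problem share the name (CONVENTIONS §1), as in every Theorems file
set_option linter.dupNamespace false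

namespace Summit.NavierStokesRegularity.NavierStokesRegularity.Theorems.FiniteDissipationLiouville.CalmSliceLocal

open MeasureTheory Set Filter Topology Metric Function TopologicalSpace InnerProductSpace
open Literature.Analysis Literature.Analysis.FluidPDE
open Summit.NavierStokesRegularity.NavierStokesRegularity.Theorems
open Summit.NavierStokesRegularity.NavierStokesRegularity.Theorems.FiniteDissipationLiouville
open scoped ENNReal NNReal RealInnerProductSpace Laplacian ContDiff

/-! ### The vorticity unsteadiness is `∂ₛΩ` -/

/-- **`curl Φₜ = (−t)∂ₜω − ω − ½(x·∇)ω`.** For a Type-I ancient mild field `w` (jointly smooth on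
the open past), `t < 0` and `ω(τ) = curl (w τ)`:
`curl (x ↦ (−t)∂ₜw(t,x) − ½w(t,x) − ½Dw(t)(x)[x]) (x) = (−t)∂ₜω(t,x) − ω(t,x) − ½Dω(t)(x)[x]`
(`curl ∂ₜ = ∂ₜ curl`, `IsSmoothSpaceTimeOn.curl_timeDerivWithin`; `curl((x·∇)w) = ω + (x·∇)ω`,
`curl_fderiv_apply_self`; linearity of the curl at points of differentiability). [cite: MajdaBertozziCUP2002, §1.1 (vector identities)] -/
theorem curl_unsteadiness_eq {C : ℝ}
    {w : ℝ → EuclideanSpace ℝ (Fin 3) → EuclideanSpace ℝ (Fin 3)} (hw : IsTypeIAncientMild C w)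
    {t : ℝ} (ht : t < 0) (x : EuclideanSpace ℝ (Fin 3)) :
    curl (fun x => (-t) • deriv (fun τ => w τ x) t - (1 / 2 : ℝ) • w t x -
        (1 / 2 : ℝ) • fderiv ℝ (w t) x x) x =
      (-t) • deriv (fun τ => curl (w τ) x) t - curl (w t) x -
        (1 / 2 : ℝ) • fderiv ℝ (curl (w t)) x x := by
  have hsm : IsSmoothSpaceTimeOn (Iio (0 : ℝ)) w := hw.contDiffOn
  have hS : IsOpen (Iio (0 : ℝ)) := isOpen_Iio
  have hSu : UniqueDiffOn ℝ (Iio (0 : ℝ)) := hS.uniqueDiffOn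
  have hcl : Iio (0 : ℝ) ⊆ closure (interior (Iio (0 : ℝ))) := by
    rw [hS.interior_eq]; exact subset_closure
  have htS : t ∈ Iio (0 : ℝ) := ht
  -- the three smooth pieces
  set A : EuclideanSpace ℝ (Fin 3) → EuclideanSpace ℝ (Fin 3) := timeDerivWithin (Iio (0 : ℝ)) w t
    with hAdef
  set U : EuclideanSpace ℝ (Fin 3) → EuclideanSpace ℝ (Fin 3) := w t with hUdef
  set D : EuclideanSpace ℝ (Fin 3) → EuclideanSpace ℝ (Fin 3) := fun y => fderiv ℝ U y y with hDdef
  have hA : ContDiff ℝ ∞ A := (hsm.timeDerivWithin hSu).contDiff_slice htS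
  have hU : ContDiff ℝ ∞ U := hw.contDiff_slice ht
  have hU2 : ContDiff ℝ 2 U := hU.of_le (by norm_cast)
  have hDs : ContDiff ℝ ∞ D := (contDiff_infty_iff_fderiv.1 hU).2.clm_apply contDiff_id
  have dA : ∀ y, DifferentiableAt ℝ A y := fun y => (hA.differentiable (by simp)) y
  have dU : ∀ y, DifferentiableAt ℝ U y := fun y => (hU.differentiable (by simp)) y
  have dD : ∀ y, DifferentiableAt ℝ D y := fun y => (hDs.differentiable (by simp)) y
  -- the field inside the curl, rewritten through the pieces
  have eA : ∀ y, deriv (fun τ => w τ y) t = A y := fun y => by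
    rw [hAdef, timeDerivWithin_eq_deriv hS htS]
  have efield : (fun x => (-t) • deriv (fun τ => w τ x) t - (1 / 2 : ℝ) • w t x -
      (1 / 2 : ℝ) • fderiv ℝ (w t) x x) =
      fun x => ((-t) • A x - (1 / 2 : ℝ) • U x) - (1 / 2 : ℝ) • D x := by
    funext y; rw [eA y]
  -- linearity of the curl
  have d1 : ∀ y, DifferentiableAt ℝ (fun x => (-t) • A x) y := fun y => by
    simpa only [Pi.smul_def] using (dA y).const_smul (-t)
  have d2 : ∀ y, DifferentiableAt ℝ (fun x => (1 / 2 : ℝ) • U x) y := fun y => by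
    simpa only [Pi.smul_def] using (dU y).const_smul (1 / 2 : ℝ)
  have d3 : ∀ y, DifferentiableAt ℝ (fun x => (1 / 2 : ℝ) • D x) y := fun y => by
    simpa only [Pi.smul_def] using (dD y).const_smul (1 / 2 : ℝ)
  have d12 : ∀ y, DifferentiableAt ℝ (fun x => (-t) • A x - (1 / 2 : ℝ) • U x) y := fun y =>
    (d1 y).sub (d2 y)
  rw [efield, curl_sub (d12 x) (d3 x), curl_sub (d1 x) (d2 x), curl_const_smul (dA x),
    curl_const_smul (dU x), curl_const_smul (dD x)]
  -- `curl A = ∂ₜ ω`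
  have hcA : curl A x = deriv (fun τ => curl (w τ) x) t := by
    rw [hAdef, hsm.curl_timeDerivWithin hSu hcl htS x, timeDerivWithin_eq_deriv hS htS]
    simp only [vorticity_apply]
  -- `curl ((x·∇)U) = ω + (x·∇)ω`
  have hcD : curl D x = curl U x + fderiv ℝ (curl U) x x := by
    rw [hDdef]; exact curl_fderiv_apply_self hU2 x
  rw [hcA, hcD, hUdef]
  module

/-! ### The vorticity-steadiness Liouville and the vorticity-flicker floor, literally for `∂ₛΩ` -/

/-- **ONE INSTANT AT WHICH THE SIMILARITY VORTICITY IS STEADY ON ONE OPEN SET KILLS A MEMBER OF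
THE STRATUM.** If `w ∈ 𝒟_{C,K}` and at some `t₀ < 0` the vorticity unsteadiness
`(−t₀)∂ₜω − ω − ½(x·∇)ω`, `ω(τ) = curl (w τ)`, vanishes on a non-empty open set of space, then
`w ≡ 0` on `t < 0` (`curl_unsteadiness_eq` + `eq_zero_of_curl_unsteadiness_eq_zero_on`). [cite: Tsai1998, Theorem 1 (p. 31)] -/
theorem eq_zero_of_vorticity_steady_on {C K : ℝ}
    {w : ℝ → EuclideanSpace ℝ (Fin 3) → EuclideanSpace ℝ (Fin 3)}
    (hw : IsTypeIAncientMild C w)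
    (hlaw : ∀ s : ℝ, s < 0 → ∫⁻ x, ‖fderiv ℝ (w s) x‖ₑ ^ 2 ≤ ENNReal.ofReal (K / Real.sqrt (-s)))
    {t₀ : ℝ} (ht₀ : t₀ < 0) {O : Set (EuclideanSpace ℝ (Fin 3))} (hO : IsOpen O) (hne : O.Nonempty)
    (hω : ∀ x ∈ O, (-t₀) • deriv (fun τ => curl (w τ) x) t₀ - curl (w t₀) x -
      (1 / 2 : ℝ) • fderiv ℝ (curl (w t₀)) x x = 0) :
    ∀ t < 0, ∀ x, w t x = 0 :=
  eq_zero_of_curl_unsteadiness_eq_zero_on hw hlaw ht₀ hO hne fun x hx => by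
    rw [curl_unsteadiness_eq hw ht₀ x]; exact hω x hx

/-- **ONE VORTICITY-CALM PARABOLIC SUB-BALL ⇒ REGULAR, literally for `∂ₛΩ`.** For all `C, K, ρ`
and `r > 0` there is `δ > 0`: a member of `𝒟_{C,K}` with
`(−t)‖(−t)∂ₜω − ω − ½(x·∇)ω‖ ≤ δ` on ONE ball `B(x₀, r√(−t))`, `‖x₀‖ ≤ ρ√(−t)`, at ONE instant is
bounded on some backward parabolic cylinder at the origin (`vorticityCalm_leaf` through
`curl_unsteadiness_eq`). [cite: Tsai1998, Theorem 1 (p. 31)] -/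
theorem vorticityCalm_leaf' (C K ρ r : ℝ) (hr : 0 < r) : ∃ δ > 0,
    ∀ (w : ℝ → EuclideanSpace ℝ (Fin 3) → EuclideanSpace ℝ (Fin 3)),
      IsTypeIAncientMild C w →
      (∀ s : ℝ, s < 0 → ∫⁻ x, ‖fderiv ℝ (w s) x‖ₑ ^ 2 ≤ ENNReal.ofReal (K / Real.sqrt (-s))) →
      ∀ t < 0, ∀ x₀ : EuclideanSpace ℝ (Fin 3), ‖x₀‖ ≤ ρ * Real.sqrt (-t) →
      (∀ x ∈ ball x₀ (r * Real.sqrt (-t)),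
        ‖(-t) • ((-t) • deriv (fun τ => curl (w τ) x) t - curl (w t) x -
          (1 / 2 : ℝ) • fderiv ℝ (curl (w t)) x x)‖ ≤ δ) →
      ¬ (∀ r > 0, ∀ M : ℝ, ∃ t ∈ Set.Ioo (-(r ^ 2)) (0 : ℝ),
        ∃ x ∈ Metric.ball (0 : EuclideanSpace ℝ (Fin 3)) r, M < ‖w t x‖) := by
  obtain ⟨δ, hδ, h⟩ := vorticityCalm_leaf C K ρ r hr
  refine ⟨δ, hδ, fun w hw hlaw t ht x₀ hx₀ hcalm => h w hw hlaw t ht x₀ hx₀ fun x hx => ?_⟩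
  rw [curl_unsteadiness_eq hw ht x]
  exact hcalm x hx

/-- **PORTRAIT: the similarity vorticity of a finite-dissipation Type-I singularity is steady on no
parabolic pocket.** For every SINGULAR member of `𝒟_{C,K}`, every instant `t < 0` and every centre
`‖x₀‖ ≤ ρ√(−t)`, some point of `B(x₀, r√(−t))` has `(−t)‖(−t)∂ₜω − ω − ½(x·∇)ω‖ > δ(C,K,ρ,r)`,
`ω = curl w` — i.e. `‖∂ₛΩ‖ > δ` somewhere in every sub-ball `B(c, r)`, `‖c‖ ≤ ρ`, of the
similarity variables, at every similarity time. -/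
theorem vorticityFlicker_floor_of_singular' (C K ρ r : ℝ) (hr : 0 < r) : ∃ δ > 0,
    ∀ (w : ℝ → EuclideanSpace ℝ (Fin 3) → EuclideanSpace ℝ (Fin 3)),
      IsTypeIAncientMild C w →
      (∀ s : ℝ, s < 0 → ∫⁻ x, ‖fderiv ℝ (w s) x‖ₑ ^ 2 ≤ ENNReal.ofReal (K / Real.sqrt (-s))) →
      (∀ r > 0, ∀ M : ℝ, ∃ t ∈ Set.Ioo (-(r ^ 2)) (0 : ℝ),
        ∃ x ∈ Metric.ball (0 : EuclideanSpace ℝ (Fin 3)) r, M < ‖w t x‖) →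
      ∀ t < 0, ∀ x₀ : EuclideanSpace ℝ (Fin 3), ‖x₀‖ ≤ ρ * Real.sqrt (-t) →
        ∃ x ∈ ball x₀ (r * Real.sqrt (-t)),
          δ < ‖(-t) • ((-t) • deriv (fun τ => curl (w τ) x) t - curl (w t) x -
            (1 / 2 : ℝ) • fderiv ℝ (curl (w t)) x x)‖ := by
  obtain ⟨δ, hδ, h⟩ := vorticityCalm_leaf' C K ρ r hr
  refine ⟨δ, hδ, fun w hw hlaw hsing t ht x₀ hx₀ => ?_⟩
  by_contra hnot
  push Not at hnot
  exact h w hw hlaw t ht x₀ hx₀ hnot hsing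

end Summit.NavierStokesRegularity.NavierStokesRegularity.Theorems.FiniteDissipationLiouville.CalmSliceLocal

end
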